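import Mathlib
import Literature.NumberTheory.LFunctions.Zhang2022.Section13MeanSquareB
import Literature.NumberTheory.LFunctions.Zhang2022.Section13U007b
import HarnessLib

/-!
# Zhang (2022) §3 Lemma 3.3 (i) at work: the `𝔓`-scale `Ψ`-mean squares of the SHORT Dirichlet
# polynomials `B(s,ψ)`, `H₁₄ + ι₂H₁₂`, `H₂`, `K(s,ψ)`, `N(s,ψ)` on the strip `|σ − ½| ≤ 2α`

Topic `Literature/NumberTheory/LFunctions/Zhang2022` (Landau–Siegel audit tree; verdict-neutral).
Y. Zhang, *Discrete mean estimates and the Landau–Siegel zero*, arXiv:2211.02515v1 (2022)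
[Zhang2022LandauSiegel] — **an unrefereed manuscript under adjudication**; this THEOREM-ONLY file proves
mean-square bounds for objects of the manuscript and asserts nothing about its Theorems 1–2 or about
Landau–Siegel zeros. ZHANG-L lane, LIB-B shape adapter (helper under the leaf
`Typed.Section15A.Eq15_6`, node §15.u008 (β) = `Typed.Section15A.Step15_u008beta`, and for every other
"Cauchy's inequality and Lemma 3.3" step whose polynomial has length `≤ P`).

Lemma 3.3 p. 14 has TWO assertions. The tree's kernel-proved forms are
`Skeleton.lemma33a_sum_le` — (i): for a polynomial of length `≤ P`,
`Σ_{ψ∈T} |Σ_{n≤P} c(n)ψ(n)n^{−s}|² ≤ 𝔓 · Σ_{n≤P} |c(n)|²n^{−2σ}` with `𝔓 = Σ_{p∼P} p ≍ P²𝓛⁻⁷⁷`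
(orthogonality modulo each `p` of the window, no large sieve) — and `Skeleton.lemma33b_sum_le` — (ii):
length `≤ P²`, constant `C₃₃·P²`. The companion file `Section13MeanSquareB` (WP14 item I3-B) runs every
instance through (ii). The polynomials `B(s,ψ)` ((12.2)/(15.1): length `PT⁻²η₊ < P`),
`H₁₄ + ι₂H₁₂`, `H₂` (length `< P₁ = P^{0.504}`), `K(s,ψ)` (Lemma 6.1: length `2P₄ = 2Pt₀T⁻²`) and
`N(s,ψ)` (length `2T²`) are all SHORTER THAN `P`, so assertion (i) applies and saves the factor
`P²/𝔓 ≍ 𝓛⁷⁷` (resp. `𝓛^{38.5}` after a square root in a Cauchy–Schwarz/Hölder step):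

* generic forms `meanSq_pc_le_short` / `meanSq_pcConj_le_short` (`ψχ`- resp. `conj(ψχ)`-twisted,
  arbitrary coefficients, `N ≤ ⌊P⌋ + 1`), `meanSq_psiW_le_short` / `meanSq_psiBarW_le_short`
  (`ψ`- resp. `ψ̄`-twisted with a weight `w(n)`), and the divisor-majorant forms
  `meanSq_pc_le_of_le_tau_short` / `meanSq_pcConj_le_of_le_tau_short`
  (`|a(n)| ≤ Kτ_j(n)` ⇒ `≤ 𝔓·e^{8π}·majorantConst(j²,2j)·K²·(log N)^{j²}` on `|σ − ½| ≤ 2α`);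
* instances on `|σ − ½| ≤ 2α`, `𝓛 ≥ 3`, any finite `T ⊆ Ψ`:
  `meanSq_Bpoly_le_frakP` — `Σ_{ψ∈T} |B(s,ψ)|² ≤ C_B·𝔓·𝓛³⁶`; `meanSq_BpolyDual_le_frakP`;
  `meanSq_B1_le_frakP`, `meanSq_H2_le_frakP` (`≤ C·𝔓·𝓛⁹`); `meanSq_Nchar_le_frakP` /
  `meanSq_NcharBar_le_frakP` (`≤ e^{8π}·𝔓·(1 + 𝓛⁹)`); `meanSq_Kchar_le_frakP` /
  `meanSq_KcharBar_le_frakP` (same bound, under the eventual size hypothesis `2P₄ + 1 ≤ P`,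
  supplied by `eventually_two_P4_add_one_le`).

Budget remark for §15.u008 (β) (RT15-int-1, zl-closer-1's `Step15_u008beta`, target `C·𝔓·𝓛¹²²`): with
`(Σ_Ψ|B|²)^{1/2} ≤ (C_B𝔓𝓛³⁶)^{1/2}` in the Hölder step `Σ|L₂BK| ≤ (Σ|B|²)^{1/2}(Σ|L₂|⁴)^{1/4}(Σ|K|⁴)^{1/4}`
the count is `𝓛⁹·𝓛¹⁸·(P²𝓛³⁶)^{1/2}·𝔓^{1/2} = 𝓛⁴⁵·P·𝔓^{1/2} ≤ √2·𝔓·𝓛^{83.5}` (`P² ≤ 2𝔓𝓛⁷⁷`,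
`frakP_bounds`), i.e. a margin of `𝓛^{38}` instead of the knife edge `P²𝓛⁴⁵ ≤ 2𝔓𝓛¹²²`.

Theorems only; no definitions, no new named facts; axioms standard.

## References

* Y. Zhang, arXiv:2211.02515v1 (2022), Lemma 3.3 p. 14 (tex L779–L793), §13 (13.11) p. 75,
  §12 (12.2) p. 67, §15 (15.1)–(15.2) p. 79, §6 Lemma 6.1 p. 30, §2 (2.6)–(2.9), (2.21), (2.26)–(2.27).
  [cite: Zhang2022LandauSiegel, Lemma 3.3 p.14]
-/

noncomputable section

open Complex Real ComplexConjugate Filter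

namespace Literature.NumberTheory.LFunctions.Zhang2022.Typed.Section13

open Skeleton MeanSquareMajorant

/-! ## Lemma 3.3 (i) for twisted short Dirichlet polynomials, arbitrary coefficients -/

section Generic

variable {D : ℕ} (χ : DirichletCharacter ℂ D)

/-- **Lemma 3.3 (i) for `ψχ`-twisted polynomials of length `≤ P`, arbitrary coefficients**: for any
finite `T ⊆ Ψ`, any `s`, `N ≤ ⌊P⌋ + 1` and `a : ℕ → ℂ`,
`Σ_{ψ∈T} |Σ_{1≤n<N} a(n)ψχ(n)n^{−s}|² ≤ 𝔓·Σ_{1≤n<N} |a(n)|²n^{−2σ}` (`|χ(n)| ≤ 1` absorbed into the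
coefficient; the tree's `Skeleton.lemma33a_sum_le`). [cite: Zhang2022LandauSiegel, Lemma 3.3 p.14] -/
theorem meanSq_pc_le_short (T : Finset (Chr D)) (s : ℂ) {N : ℕ} (hN : N ≤ ⌊bigP D⌋₊ + 1)
    (a : ℕ → ℂ) :
    ∑ x ∈ T, ‖∑ n ∈ Finset.Ico 1 N, a n * pc χ x n * (n : ℂ) ^ (-s)‖ ^ 2
      ≤ frakP D * ∑ n ∈ Finset.Ico 1 N, ‖a n‖ ^ 2 * (n : ℝ) ^ (-2 * s.re) := by
  classical
  set c : ℕ → ℂ := fun n => if n < N then a n * χ (n : ZMod D) else 0 with hc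
  have hfilter : (Finset.Icc 1 ⌊bigP D⌋₊).filter (fun n => n < N) = Finset.Ico 1 N := by
    ext n
    simp only [Finset.mem_filter, Finset.mem_Icc, Finset.mem_Ico]
    constructor
    · rintro ⟨⟨h1, -⟩, h3⟩; exact ⟨h1, h3⟩
    · rintro ⟨h1, h3⟩; exact ⟨⟨h1, by omega⟩, h3⟩
  have hinner : ∀ x : Chr D,
      ∑ n ∈ Finset.Ico 1 N, a n * pc χ x n * (n : ℂ) ^ (-s) =
        ∑ n ∈ Finset.Icc 1 ⌊bigP D⌋₊, c n * x.ψ (n : ZMod x.p) * (n : ℂ) ^ (-s) := by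
    intro x
    have : ∀ n, c n * x.ψ (n : ZMod x.p) * (n : ℂ) ^ (-s) =
        if n < N then a n * pc χ x n * (n : ℂ) ^ (-s) else 0 := by
      intro n; simp only [hc, pc]; split_ifs <;> ring
    simp_rw [this]
    rw [Finset.sum_ite, Finset.sum_const_zero, add_zero, hfilter]
  have hcoef : ∑ n ∈ Finset.Icc 1 ⌊bigP D⌋₊, ‖c n‖ ^ 2 * (n : ℝ) ^ (-2 * s.re) ≤
      ∑ n ∈ Finset.Ico 1 N, ‖a n‖ ^ 2 * (n : ℝ) ^ (-2 * s.re) := by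
    have : ∀ n, ‖c n‖ ^ 2 * (n : ℝ) ^ (-2 * s.re) =
        if n < N then ‖a n * χ (n : ZMod D)‖ ^ 2 * (n : ℝ) ^ (-2 * s.re) else 0 := by
      intro n; simp only [hc]; split_ifs <;> simp
    simp_rw [this]
    rw [Finset.sum_ite, Finset.sum_const_zero, add_zero, hfilter]
    refine Finset.sum_le_sum fun n _ => ?_
    have h0 : 0 ≤ (n : ℝ) ^ (-2 * s.re) := Real.rpow_nonneg (Nat.cast_nonneg n) _
    refine mul_le_mul_of_nonneg_right ?_ h0
    refine pow_le_pow_left₀ (norm_nonneg _) ?_ 2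
    rw [norm_mul]
    exact mul_le_of_le_one_right (norm_nonneg _) (DirichletCharacter.norm_le_one χ _)
  simp_rw [hinner]
  exact le_trans (lemma33a_sum_le T s c) (mul_le_mul_of_nonneg_left hcoef (frakP_nonneg D))

/-- For natural-number bases: `conj((n:ℂ)^w) = (n:ℂ)^(conj w)`. [folklore] -/
private theorem conj_natCast_cpow_short (n : ℕ) (w : ℂ) : conj ((n : ℂ) ^ w) = (n : ℂ) ^ (conj w) := by
  have harg : ((n : ℂ)).arg ≠ π := by
    rw [show (n : ℂ) = ((n : ℝ) : ℂ) by norm_cast, Complex.arg_ofReal_of_nonneg (Nat.cast_nonneg n)]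
    exact Real.pi_ne_zero.symm
  rw [Complex.cpow_conj _ _ harg]
  simp

/-- **Lemma 3.3 (i), conjugate-twisted form**: `Σ_{ψ∈T} |Σ_{1≤n<N} a(n)·conj(ψχ(n))·n^{−s}|² ≤
𝔓·Σ_{1≤n<N} |a(n)|²n^{−2σ}` for `N ≤ ⌊P⌋ + 1` (conjugate the inner sum; `Re s̄ = Re s`).
[cite: Zhang2022LandauSiegel, Lemma 3.3 p.14] -/
theorem meanSq_pcConj_le_short (T : Finset (Chr D)) (s : ℂ) {N : ℕ} (hN : N ≤ ⌊bigP D⌋₊ + 1)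
    (a : ℕ → ℂ) :
    ∑ x ∈ T, ‖∑ n ∈ Finset.Ico 1 N, a n * conj (pc χ x n) * (n : ℂ) ^ (-s)‖ ^ 2
      ≤ frakP D * ∑ n ∈ Finset.Ico 1 N, ‖a n‖ ^ 2 * (n : ℝ) ^ (-2 * s.re) := by
  have hkey : ∀ x : Chr D,
      ‖∑ n ∈ Finset.Ico 1 N, a n * conj (pc χ x n) * (n : ℂ) ^ (-s)‖ =
        ‖∑ n ∈ Finset.Ico 1 N, conj (a n) * pc χ x n * (n : ℂ) ^ (-conj s)‖ := by
    intro x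
    rw [← Complex.norm_conj, map_sum]
    congr 1
    refine Finset.sum_congr rfl fun n _ => ?_
    rw [map_mul, map_mul, Complex.conj_conj, conj_natCast_cpow_short, map_neg]
  simp_rw [hkey]
  have h := meanSq_pc_le_short χ T (conj s) hN (fun n => conj (a n))
  simp only [Complex.norm_conj, Complex.conj_re] at h
  exact h

omit χ in
/-- **Lemma 3.3 (i) for weighted `ψ`-polynomials** (`K`, `N`, the `E₁`-polynomial of Lemma 6.1): for
any finite `T ⊆ Ψ`, any `s`, `N ≤ ⌊P⌋ + 1` and any weight `w : ℕ → ℂ`,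
`Σ_{ψ∈T} |Σ_{1≤n<N} ψ(n)n^{−s}w(n)|² ≤ 𝔓·Σ_{1≤n<N} |w(n)|²n^{−2σ}`.
[cite: Zhang2022LandauSiegel, Lemma 3.3 p.14; §6 Lemma 6.1 p.30] -/
theorem meanSq_psiW_le_short (T : Finset (Chr D)) (s : ℂ) {N : ℕ} (hN : N ≤ ⌊bigP D⌋₊ + 1)
    (w : ℕ → ℂ) :
    ∑ x ∈ T, ‖∑ n ∈ Finset.Ico 1 N, x.ψ (n : ZMod x.p) * (n : ℂ) ^ (-s) * w n‖ ^ 2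
      ≤ frakP D * ∑ n ∈ Finset.Ico 1 N, ‖w n‖ ^ 2 * (n : ℝ) ^ (-2 * s.re) := by
  classical
  set c : ℕ → ℂ := fun n => if n < N then w n else 0 with hc
  have hfilter : (Finset.Icc 1 ⌊bigP D⌋₊).filter (fun n => n < N) = Finset.Ico 1 N := by
    ext n
    simp only [Finset.mem_filter, Finset.mem_Icc, Finset.mem_Ico]
    constructor
    · rintro ⟨⟨h1, -⟩, h3⟩; exact ⟨h1, h3⟩
    · rintro ⟨h1, h3⟩; exact ⟨⟨h1, by omega⟩, h3⟩
  have hinner : ∀ x : Chr D,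
      ∑ n ∈ Finset.Ico 1 N, x.ψ (n : ZMod x.p) * (n : ℂ) ^ (-s) * w n =
        ∑ n ∈ Finset.Icc 1 ⌊bigP D⌋₊, c n * x.ψ (n : ZMod x.p) * (n : ℂ) ^ (-s) := by
    intro x
    have : ∀ n, c n * x.ψ (n : ZMod x.p) * (n : ℂ) ^ (-s) =
        if n < N then x.ψ (n : ZMod x.p) * (n : ℂ) ^ (-s) * w n else 0 := by
      intro n; simp only [hc]; split_ifs <;> ring
    simp_rw [this]
    rw [Finset.sum_ite, Finset.sum_const_zero, add_zero, hfilter]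
  have hcoef : ∑ n ∈ Finset.Icc 1 ⌊bigP D⌋₊, ‖c n‖ ^ 2 * (n : ℝ) ^ (-2 * s.re) =
      ∑ n ∈ Finset.Ico 1 N, ‖w n‖ ^ 2 * (n : ℝ) ^ (-2 * s.re) := by
    have : ∀ n, ‖c n‖ ^ 2 * (n : ℝ) ^ (-2 * s.re) =
        if n < N then ‖w n‖ ^ 2 * (n : ℝ) ^ (-2 * s.re) else 0 := by
      intro n; simp only [hc]; split_ifs <;> simp
    simp_rw [this]
    rw [Finset.sum_ite, Finset.sum_const_zero, add_zero, hfilter]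
  simp_rw [hinner]
  exact le_trans (lemma33a_sum_le T s c) (le_of_eq (by rw [hcoef]))

omit χ in
/-- **Lemma 3.3 (i) for weighted `ψ̄`-polynomials** (`K(·,ψ̄)`, `N(·,ψ̄)`): the conjugate-twisted form
of `meanSq_psiW_le_short`. [cite: Zhang2022LandauSiegel, Lemma 3.3 p.14; §6 Lemma 6.1 p.30] -/
theorem meanSq_psiBarW_le_short (T : Finset (Chr D)) (s : ℂ) {N : ℕ} (hN : N ≤ ⌊bigP D⌋₊ + 1)
    (w : ℕ → ℂ) :
    ∑ x ∈ T, ‖∑ n ∈ Finset.Ico 1 N, conj (x.ψ (n : ZMod x.p)) * (n : ℂ) ^ (-s) * w n‖ ^ 2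
      ≤ frakP D * ∑ n ∈ Finset.Ico 1 N, ‖w n‖ ^ 2 * (n : ℝ) ^ (-2 * s.re) := by
  have hkey : ∀ x : Chr D,
      ‖∑ n ∈ Finset.Ico 1 N, conj (x.ψ (n : ZMod x.p)) * (n : ℂ) ^ (-s) * w n‖ =
        ‖∑ n ∈ Finset.Ico 1 N, x.ψ (n : ZMod x.p) * (n : ℂ) ^ (-conj s) * conj (w n)‖ := by
    intro x
    rw [← Complex.norm_conj, map_sum]
    congr 1
    refine Finset.sum_congr rfl fun n _ => ?_
    rw [map_mul, map_mul, Complex.conj_conj, conj_natCast_cpow_short, map_neg]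
  simp_rw [hkey]
  have h := meanSq_psiW_le_short T (conj s) hN (fun n => conj (w n))
  simp only [Complex.norm_conj, Complex.conj_re] at h
  exact h

omit χ in
/-- `⌊P⌋ ≤ ⌊P²⌋` (`P = exp 𝓛⁹ ≥ 1`). [cite: Zhang2022LandauSiegel, §2 (2.6)] -/
theorem floor_bigP_le_floor_sq (D : ℕ) : ⌊bigP D⌋₊ ≤ ⌊bigP D ^ 2⌋₊ := by
  refine Nat.floor_mono ?_
  have h0 : 0 ≤ ell D := Real.log_natCast_nonneg D
  have h1 : 1 ≤ bigP D := by rw [bigP]; exact Real.one_le_exp (pow_nonneg h0 9)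
  nlinarith

/-- **Lemma 3.3 (i), divisor-majorant form**: on the strip `|σ − ½| ≤ 2α`, for any finite `T ⊆ Ψ`,
`2 ≤ N ≤ ⌊P⌋ + 1` and coefficients `|a(n)| ≤ K·τ_j(n)` (`n ≥ 1`):
`Σ_{ψ∈T} |Σ_{1≤n<N} a(n)ψχ(n)n^{−s}|² ≤ 𝔓·e^{8π}·majorantConst(j²,2j)·K²·(log N)^{j²}`.
[cite: Zhang2022LandauSiegel, Lemma 3.3 p.14; §13 p.75] -/
theorem meanSq_pc_le_of_le_tau_short (hL : 1 ≤ ell D) (T : Finset (Chr D)) {s : ℂ}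
    (hs : |s.re - 1 / 2| ≤ 2 * alpha D) {N : ℕ} (hN2 : 2 ≤ N) (hN : N ≤ ⌊bigP D⌋₊ + 1)
    {a : ℕ → ℂ} {K : ℝ} (j : ℕ) (ha : ∀ n, n ≠ 0 → ‖a n‖ ≤ K * tau j n) :
    ∑ x ∈ T, ‖∑ n ∈ Finset.Ico 1 N, a n * pc χ x n * (n : ℂ) ^ (-s)‖ ^ 2
      ≤ frakP D * (Real.exp (8 * π) * majorantConst (j ^ 2) (2 * j) * K ^ 2 * Real.log N ^ (j ^ 2)) := by
  have h1 := meanSq_pc_le_short χ T s hN a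
  have hN' : N ≤ ⌊bigP D ^ 2⌋₊ + 1 := le_trans hN (by have := floor_bigP_le_floor_sq D; omega)
  have h2 : ∑ n ∈ Finset.Ico 1 N, ‖a n‖ ^ 2 * (n : ℝ) ^ (-2 * s.re) ≤
      ∑ n ∈ Finset.Ico 1 N, (K * tau j n) ^ 2 * (n : ℝ) ^ (-2 * s.re) := by
    refine Finset.sum_le_sum fun n hn => ?_
    rw [Finset.mem_Ico] at hn
    have h0 : 0 ≤ (n : ℝ) ^ (-2 * s.re) := Real.rpow_nonneg (Nat.cast_nonneg n) _
    exact mul_le_mul_of_nonneg_right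
      (pow_le_pow_left₀ (norm_nonneg _) (ha n (by omega)) 2) h0
  have h3 := sum_tau_sq_rpow_le hL hs hN2 hN' K j
  exact h1.trans (mul_le_mul_of_nonneg_left (h2.trans h3) (frakP_nonneg D))

/-- **Lemma 3.3 (i), divisor-majorant dual form** (conjugate twist `conj(ψχ(n))`).
[cite: Zhang2022LandauSiegel, Lemma 3.3 p.14; §13 p.75] -/
theorem meanSq_pcConj_le_of_le_tau_short (hL : 1 ≤ ell D) (T : Finset (Chr D)) {s : ℂ}
    (hs : |s.re - 1 / 2| ≤ 2 * alpha D) {N : ℕ} (hN2 : 2 ≤ N) (hN : N ≤ ⌊bigP D⌋₊ + 1)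
    {a : ℕ → ℂ} {K : ℝ} (j : ℕ) (ha : ∀ n, n ≠ 0 → ‖a n‖ ≤ K * tau j n) :
    ∑ x ∈ T, ‖∑ n ∈ Finset.Ico 1 N, a n * conj (pc χ x n) * (n : ℂ) ^ (-s)‖ ^ 2
      ≤ frakP D * (Real.exp (8 * π) * majorantConst (j ^ 2) (2 * j) * K ^ 2 * Real.log N ^ (j ^ 2)) := by
  have h1 := meanSq_pcConj_le_short χ T s hN a
  have hN' : N ≤ ⌊bigP D ^ 2⌋₊ + 1 := le_trans hN (by have := floor_bigP_le_floor_sq D; omega)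
  have h2 : ∑ n ∈ Finset.Ico 1 N, ‖a n‖ ^ 2 * (n : ℝ) ^ (-2 * s.re) ≤
      ∑ n ∈ Finset.Ico 1 N, (K * tau j n) ^ 2 * (n : ℝ) ^ (-2 * s.re) := by
    refine Finset.sum_le_sum fun n hn => ?_
    rw [Finset.mem_Ico] at hn
    have h0 : 0 ≤ (n : ℝ) ^ (-2 * s.re) := Real.rpow_nonneg (Nat.cast_nonneg n) _
    exact mul_le_mul_of_nonneg_right
      (pow_le_pow_left₀ (norm_nonneg _) (ha n (by omega)) 2) h0
  have h3 := sum_tau_sq_rpow_le hL hs hN2 hN' K j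
  exact h1.trans (mul_le_mul_of_nonneg_left (h2.trans h3) (frakP_nonneg D))

omit χ in
/-- On the strip `|σ − ½| ≤ 2α`, for a weight `|w(n)| ≤ 1` and `N ≤ ⌊P⌋ + 1`:
`Σ_{1≤n<N} |w(n)|²·n^{−2σ} ≤ e^{8π}·(1 + log N)` (`n^{−2σ} ≤ e^{8π}/n` for `n ≤ P²`, harmonic sum).
[cite: Zhang2022LandauSiegel, §13 p.75; §2 (2.10)] -/
theorem sum_weight_sq_rpow_le (hL : 1 ≤ ell D) {s : ℂ} (hs : |s.re - 1 / 2| ≤ 2 * alpha D)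
    {N : ℕ} (hN : N ≤ ⌊bigP D⌋₊ + 1) {w : ℕ → ℂ} (hw : ∀ n, ‖w n‖ ≤ 1) :
    ∑ n ∈ Finset.Ico 1 N, ‖w n‖ ^ 2 * (n : ℝ) ^ (-2 * s.re) ≤ Real.exp (8 * π) * (1 + Real.log N) := by
  have he : |-2 * s.re + 1| ≤ 4 * alpha D := by
    have : -2 * s.re + 1 = -2 * (s.re - 1 / 2) := by ring
    rw [this, abs_mul, abs_neg, abs_two]
    linarith
  have hP2pos : 0 < bigP D ^ 2 := pow_pos (Real.exp_pos _) 2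
  have hPP := floor_bigP_le_floor_sq D
  have hterm : ∀ n ∈ Finset.Ico 1 N, ‖w n‖ ^ 2 * (n : ℝ) ^ (-2 * s.re) ≤
      Real.exp (8 * π) * (n : ℝ)⁻¹ := by
    intro n hn
    rw [Finset.mem_Ico] at hn
    have hnP : (n : ℝ) ≤ bigP D ^ 2 := by
      have : n ≤ ⌊bigP D ^ 2⌋₊ := by omega
      exact le_trans (by exact_mod_cast this) (Nat.floor_le hP2pos.le)
    have h := rpow_le_exp_eight_pi_mul_inv hL he hn.1 hnP
    have hw1 : ‖w n‖ ^ 2 ≤ 1 := by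
      calc ‖w n‖ ^ 2 ≤ 1 ^ 2 := pow_le_pow_left₀ (norm_nonneg _) (hw n) 2
        _ = 1 := one_pow 2
    have h0 : 0 ≤ (n : ℝ) ^ (-2 * s.re) := Real.rpow_nonneg (Nat.cast_nonneg n) _
    calc ‖w n‖ ^ 2 * (n : ℝ) ^ (-2 * s.re) ≤ 1 * (n : ℝ) ^ (-2 * s.re) :=
          mul_le_mul_of_nonneg_right hw1 h0
      _ ≤ Real.exp (8 * π) * (n : ℝ)⁻¹ := by rw [one_mul]; exact h
  have hharm : ∑ n ∈ Finset.Ico 1 N, (n : ℝ)⁻¹ ≤ 1 + Real.log N := by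
    rcases Nat.lt_or_ge N 2 with hN1 | hN2
    · interval_cases N
      · simp
      · simp
    · have hIco : Finset.Ico 1 N = Finset.Icc 1 (N - 1) := by
        ext n; simp only [Finset.mem_Ico, Finset.mem_Icc]; omega
      have h := harmonic_le_one_add_log (N - 1)
      rw [harmonic_eq_sum_Icc] at h
      push_cast at h
      rw [hIco]
      refine h.trans ?_
      have hlog : Real.log ((N - 1 : ℕ) : ℝ) ≤ Real.log N := by
        apply Real.log_le_log
        · exact_mod_cast (show 0 < N - 1 by omega)
        · exact_mod_cast Nat.sub_le N 1
      linarith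
  calc ∑ n ∈ Finset.Ico 1 N, ‖w n‖ ^ 2 * (n : ℝ) ^ (-2 * s.re)
      ≤ ∑ n ∈ Finset.Ico 1 N, Real.exp (8 * π) * (n : ℝ)⁻¹ := Finset.sum_le_sum hterm
    _ = Real.exp (8 * π) * ∑ n ∈ Finset.Ico 1 N, (n : ℝ)⁻¹ := by rw [Finset.mul_sum]
    _ ≤ Real.exp (8 * π) * (1 + Real.log N) := mul_le_mul_of_nonneg_left hharm (Real.exp_nonneg _)

omit χ in
/-- **Weighted `ψ`-polynomials of length `≤ P` with `|w| ≤ 1` on the strip**: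
`Σ_{ψ∈T} |Σ_{1≤n<N} ψ(n)n^{−s}w(n)|² ≤ 𝔓·e^{8π}·(1 + log N)`.
[cite: Zhang2022LandauSiegel, Lemma 3.3 p.14; §6 Lemma 6.1 p.30] -/
theorem meanSq_psiW_le_short_of_le_one (hL : 1 ≤ ell D) (T : Finset (Chr D)) {s : ℂ}
    (hs : |s.re - 1 / 2| ≤ 2 * alpha D) {N : ℕ} (hN : N ≤ ⌊bigP D⌋₊ + 1) {w : ℕ → ℂ}
    (hw : ∀ n, ‖w n‖ ≤ 1) :
    ∑ x ∈ T, ‖∑ n ∈ Finset.Ico 1 N, x.ψ (n : ZMod x.p) * (n : ℂ) ^ (-s) * w n‖ ^ 2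
      ≤ frakP D * (Real.exp (8 * π) * (1 + Real.log N)) :=
  (meanSq_psiW_le_short T s hN w).trans
    (mul_le_mul_of_nonneg_left (sum_weight_sq_rpow_le hL hs hN hw) (frakP_nonneg D))

omit χ in
/-- **Weighted `ψ̄`-polynomials of length `≤ P` with `|w| ≤ 1` on the strip**:
`Σ_{ψ∈T} |Σ_{1≤n<N} ψ̄(n)n^{−s}w(n)|² ≤ 𝔓·e^{8π}·(1 + log N)`.
[cite: Zhang2022LandauSiegel, Lemma 3.3 p.14; §6 Lemma 6.1 p.30] -/
theorem meanSq_psiBarW_le_short_of_le_one (hL : 1 ≤ ell D) (T : Finset (Chr D)) {s : ℂ}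
    (hs : |s.re - 1 / 2| ≤ 2 * alpha D) {N : ℕ} (hN : N ≤ ⌊bigP D⌋₊ + 1) {w : ℕ → ℂ}
    (hw : ∀ n, ‖w n‖ ≤ 1) :
    ∑ x ∈ T, ‖∑ n ∈ Finset.Ico 1 N, conj (x.ψ (n : ZMod x.p)) * (n : ℂ) ^ (-s) * w n‖ ^ 2
      ≤ frakP D * (Real.exp (8 * π) * (1 + Real.log N)) :=
  (meanSq_psiBarW_le_short T s hN w).trans
    (mul_le_mul_of_nonneg_left (sum_weight_sq_rpow_le hL hs hN hw) (frakP_nonneg D))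

end Generic

/-! ## Sizes of the truncation points against `⌊P⌋ + 1` -/

/-- For `𝓛 ≥ 3`: `⌈P₁⌉ ≤ ⌊P⌋ + 1`, `⌊PT⁻²⌋ + 1 ≤ ⌊P⌋ + 1`, `⌈2T²⌉ ≤ ⌊P⌋ + 1`, `⌈T³⌉ ≤ ⌊P⌋ + 1`,
`log(⌊P⌋ + 1) ≤ 1 + 𝓛⁹`, and the two logarithms of `truncations_of_three_le`.
[cite: Zhang2022LandauSiegel, §2 (2.6), (2.21); §6 Lemma 6.1 p.30; §7 (7.2)] -/
theorem short_truncations_of_three_le {D : ℕ} (hL : 3 ≤ ell D) :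
    ⌈Skeleton.P1 D⌉₊ ≤ ⌊bigP D⌋₊ + 1 ∧ ⌊bigP D / bigT D ^ 2⌋₊ + 1 ≤ ⌊bigP D⌋₊ + 1 ∧
      ⌈2 * bigT D ^ 2⌉₊ ≤ ⌊bigP D⌋₊ + 1 ∧ ⌈bigT D ^ 3⌉₊ ≤ ⌊bigP D⌋₊ + 1 := by
  obtain ⟨hP1P, hPTP, hPT1, hPP2⟩ := sizes_of_three_le hL
  have hL1 : 1 ≤ ell D := by linarith
  have hL0 : 0 < ell D := by linarith
  have hP : 0 < bigP D := Real.exp_pos _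
  have hP10 : 0 ≤ Skeleton.P1 D := Real.rpow_nonneg hP.le _
  -- `3T³ ≤ P` for `𝓛 ≥ 3` (`log 3 + 3𝓛^{1.1} ≤ 𝓛⁹`)
  have h11 : ell D ^ (1.1 : ℝ) ≤ ell D ^ 2 := by
    have := Real.rpow_le_rpow_of_exponent_le hL1 (by norm_num : (1.1 : ℝ) ≤ 2)
    rwa [Real.rpow_two] at this
  have h9 : ell D ^ 9 = ell D ^ 2 * ell D ^ 7 := by ring
  have h7 : (3 : ℝ) ^ 7 ≤ ell D ^ 7 := pow_le_pow_left₀ (by norm_num) hL 7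
  have h2sq : (9 : ℝ) ≤ ell D ^ 2 := by nlinarith
  have hlog3 : Real.log 3 < 2 := by
    have h := Real.log_lt_sub_one_of_pos (by norm_num : (0 : ℝ) < 3) (by norm_num)
    linarith
  have hkey : Real.log 3 + 3 * ell D ^ (1.1 : ℝ) ≤ ell D ^ 9 := by
    rw [h9]; nlinarith
  have hT1 : 1 ≤ bigT D := by rw [bigT]; exact Real.one_le_exp (by positivity)
  have h3T3 : 3 * bigT D ^ 3 ≤ bigP D := by
    rw [bigT, bigP, ← Real.exp_nat_mul]
    have : (3 : ℝ) * Real.exp ((3 : ℕ) * ell D ^ (1.1 : ℝ)) =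
        Real.exp (Real.log 3 + 3 * ell D ^ (1.1 : ℝ)) := by
      rw [Real.exp_add, Real.exp_log (by norm_num : (0 : ℝ) < 3)]; push_cast; ring
    rw [this]
    exact Real.exp_le_exp.mpr hkey
  have hT23 : bigT D ^ 2 ≤ bigT D ^ 3 := pow_le_pow_right₀ hT1 (by norm_num)
  have hT31 : 1 ≤ bigT D ^ 3 := one_le_pow₀ hT1
  refine ⟨?_, ?_, ?_, ?_⟩
  · have h1 : ⌈Skeleton.P1 D⌉₊ ≤ ⌊bigP D⌋₊ := by
      refine Nat.le_floor ?_
      exact le_trans (Nat.ceil_lt_add_one hP10).le hP1P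
    omega
  · have h1 : ⌊bigP D / bigT D ^ 2⌋₊ ≤ ⌊bigP D⌋₊ := Nat.floor_mono (by linarith)
    omega
  · have h1 : ⌈2 * bigT D ^ 2⌉₊ ≤ ⌊bigP D⌋₊ := by
      refine Nat.le_floor ?_
      have h2 : 2 * bigT D ^ 2 + 1 ≤ bigP D := by nlinarith
      exact le_trans (Nat.ceil_lt_add_one (by positivity)).le h2
    omega
  · have h1 : ⌈bigT D ^ 3⌉₊ ≤ ⌊bigP D⌋₊ := by
      refine Nat.le_floor ?_
      have h2 : bigT D ^ 3 + 1 ≤ bigP D := by nlinarith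
      exact le_trans (Nat.ceil_lt_add_one (by positivity)).le h2
    omega

/-- For `𝓛 ≥ 1` and `N ≤ ⌊P⌋ + 1`: `log N ≤ 1 + 𝓛⁹` (`N ≤ P + 1 ≤ e·P`).
[cite: Zhang2022LandauSiegel, §2 (2.6)] -/
theorem log_le_of_le_floor_bigP {D : ℕ} {N : ℕ} (hN : N ≤ ⌊bigP D⌋₊ + 1) :
    Real.log N ≤ 1 + ell D ^ 9 := by
  have hP : 0 < bigP D := Real.exp_pos _
  have hℓ : 0 ≤ ell D := Real.log_natCast_nonneg D
  have h9 : 0 ≤ ell D ^ 9 := pow_nonneg hℓ 9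
  have hP1 : 1 ≤ bigP D := by rw [bigP]; exact Real.one_le_exp h9
  rcases Nat.eq_zero_or_pos N with h0 | hpos
  · rw [h0]; simp; linarith
  · have hNr : (N : ℝ) ≤ bigP D + 1 := by
      calc (N : ℝ) ≤ ((⌊bigP D⌋₊ + 1 : ℕ) : ℝ) := by exact_mod_cast hN
        _ = (⌊bigP D⌋₊ : ℝ) + 1 := by push_cast; ring
        _ ≤ bigP D + 1 := by linarith [Nat.floor_le hP.le]
    have h2 : bigP D + 1 ≤ Real.exp 1 * bigP D := by
      have he : (2 : ℝ) ≤ Real.exp 1 := by linarith [Real.add_one_le_exp (1 : ℝ)]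
      nlinarith
    calc Real.log N ≤ Real.log (Real.exp 1 * bigP D) :=
          Real.log_le_log (by exact_mod_cast hpos) (hNr.trans h2)
      _ = 1 + ell D ^ 9 := by
          rw [Real.log_mul (Real.exp_pos 1).ne' hP.ne', Real.log_exp, bigP, Real.log_exp]

/-- `𝓛 = log D → ∞`. [cite: Zhang2022LandauSiegel, §2 (2.1)] -/
private theorem tendsto_ell_short : Tendsto (fun D : ℕ => ell D) atTop atTop :=
  Real.tendsto_log_atTop.comp tendsto_natCast_atTop_atTop

/-- **`2P₄ + 1 ≤ P` for all large `D`** (`P₄ = Pt₀T⁻²`, `4t₀ = 4𝓛⁵¹⁹ ≤ T² = e^{2𝓛^{1.1}}` eventually,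
and `P/2 + 1 ≤ P`). [cite: Zhang2022LandauSiegel, §2 (2.6), (2.8); §6 Lemma 6.1 p.30] -/
theorem eventually_two_P4_add_one_le : ∃ D₀ : ℕ, ∀ D : ℕ, D₀ ≤ D → 2 * P4 D + 1 ≤ bigP D := by
  have h1 : ∀ᶠ L : ℝ in atTop, ‖L ^ 519‖ ≤ 1 / 4 * ‖Real.exp (2 * L)‖ :=
    (isLittleO_pow_exp_pos_mul_atTop 519 (by norm_num : (0 : ℝ) < 2)).bound (by norm_num)
  have h2 : ∀ᶠ L : ℝ in atTop, 1 ≤ L := eventually_ge_atTop 1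
  obtain ⟨D₀, h⟩ := Filter.eventually_atTop.mp (tendsto_ell_short.eventually (h1.and h2))
  refine ⟨D₀, fun D hD => ?_⟩
  obtain ⟨ha, hb⟩ := h D hD
  rw [Real.norm_of_nonneg (by positivity), Real.norm_of_nonneg (Real.exp_pos _).le] at ha
  have hc : Real.exp (2 * ell D) ≤ Real.exp (2 * ell D ^ (1.1 : ℝ)) := by
    apply Real.exp_le_exp.mpr
    have := Real.self_le_rpow_of_one_le hb (by norm_num : (1 : ℝ) ≤ 1.1)
    linarith
  have hT2 : bigT D ^ 2 = Real.exp (2 * ell D ^ (1.1 : ℝ)) := by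
    rw [bigT, ← Real.exp_nat_mul]; norm_num
  have hT2pos : 0 < bigT D ^ 2 := by rw [hT2]; exact Real.exp_pos _
  have ht0 : 4 * t0 D ≤ bigT D ^ 2 := by rw [t0, hT2]; linarith
  have hP : 0 < bigP D := Real.exp_pos _
  have hP2 : 2 ≤ bigP D := by
    rw [bigP]
    have h9 : (1 : ℝ) ≤ ell D ^ 9 := one_le_pow₀ hb
    linarith [Real.add_one_le_exp (ell D ^ 9)]
  -- `2P₄ = P · (2t₀/T²) ≤ P/2`
  have hratio : 2 * t0 D / bigT D ^ 2 ≤ 1 / 2 := by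
    rw [div_le_iff₀ hT2pos]; linarith
  have h2P4 : 2 * P4 D ≤ bigP D / 2 := by
    have : 2 * P4 D = bigP D * (2 * t0 D / bigT D ^ 2) := by rw [P4]; ring
    rw [this]
    calc bigP D * (2 * t0 D / bigT D ^ 2) ≤ bigP D * (1 / 2) :=
          mul_le_mul_of_nonneg_left hratio hP.le
      _ = bigP D / 2 := by ring
  linarith

/-- Under `2P₄ + 1 ≤ P`: `⌈2P₄⌉ ≤ ⌊P⌋ + 1`. [cite: Zhang2022LandauSiegel, §6 Lemma 6.1 p.30] -/
theorem ceil_two_P4_le {D : ℕ} (h : 2 * P4 D + 1 ≤ bigP D) : ⌈2 * P4 D⌉₊ ≤ ⌊bigP D⌋₊ + 1 := by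
  have hP4 : 0 ≤ 2 * P4 D := by
    have hℓ : 0 ≤ ell D := Real.log_natCast_nonneg D
    have : 0 ≤ P4 D := by
      rw [P4, t0]
      exact mul_nonneg (div_nonneg (Real.exp_pos _).le (pow_nonneg (Real.exp_pos _).le 2))
        (pow_nonneg hℓ 519)
    linarith
  have h1 : ⌈2 * P4 D⌉₊ ≤ ⌊bigP D⌋₊ :=
    Nat.le_floor (le_trans (Nat.ceil_lt_add_one hP4).le h)
  omega

/-! ## The instances: `B`, `B₁ = H₁₄ + ι₂H₁₂`, `B₂ = H₂`, `K`, `N` at the `𝔓`-scale -/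

section Instances

variable {D : ℕ} (χ : DirichletCharacter ℂ D) (x : Chr D)

omit x in
/-- **`Σ_{ψ∈T} |(H₁₄ + ι₂H₁₂)(s,ψ)|² ≤ e^{8π}·majorantConst(1,2)·(1+|ι₂|)²·𝔓·𝓛⁹`** for `𝓛 ≥ 3`, any
finite `T ⊆ Ψ`, `|σ − ½| ≤ 2α` (length `< P₁ < P`: Lemma 3.3 (i)).
[cite: Zhang2022LandauSiegel, Lemma 3.3 p.14; §12 (12.2) p.67; §13 (13.11) p.75] -/
theorem meanSq_B1_le_frakP (hL : 3 ≤ ell D) (T : Finset (Chr D)) {s : ℂ}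
    (hs : |s.re - 1 / 2| ≤ 2 * alpha D) :
    ∑ x ∈ T, ‖H14 χ x s + iota2 * H12 χ x s‖ ^ 2 ≤
      Real.exp (8 * π) * majorantConst 1 2 * (1 + ‖iota2‖) ^ 2 * frakP D * ell D ^ 9 := by
  have hL1 : 1 ≤ ell D := by linarith
  have hD2 : 2 ≤ Real.log D := by have h := hL; rw [ell] at h; linarith
  obtain ⟨⟨hN2, -, hlog⟩, -⟩ := truncations_of_three_le hL
  obtain ⟨hN, -, -, -⟩ := short_truncations_of_three_le hL
  have ha : ∀ n : ℕ, n ≠ 0 →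
      ‖((if (n : ℝ) < bigP D ^ (1 / 2 : ℝ) then vk1 D n else 0) + iota2 * vk2 D n)‖ ≤
      (1 + ‖iota2‖) * tau 1 n := fun n hn => by
    rw [tau_one_apply hn, mul_one]; exact norm_coefB1_le hD2 n
  have h := meanSq_pc_le_of_le_tau_short χ hL1 T hs hN2 hN 1 ha
  simp_rw [B1_eq_sum χ]
  refine h.trans ?_
  have hK : 0 ≤ frakP D * (Real.exp (8 * π) * majorantConst 1 2 * (1 + ‖iota2‖) ^ 2) :=
    mul_nonneg (frakP_nonneg D) (mul_nonneg (mul_nonneg (Real.exp_nonneg _)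
      (majorantConst_pos _ _).le) (sq_nonneg _))
  have := mul_le_mul_of_nonneg_left hlog hK
  simp only [one_pow, pow_one, Nat.mul_one] at this ⊢
  calc frakP D * (Real.exp (8 * π) * majorantConst 1 2 * (1 + ‖iota2‖) ^ 2 *
        Real.log (⌈Skeleton.P1 D⌉₊ : ℕ))
      = frakP D * (Real.exp (8 * π) * majorantConst 1 2 * (1 + ‖iota2‖) ^ 2) *
        Real.log (⌈Skeleton.P1 D⌉₊ : ℕ) := by ring
    _ ≤ frakP D * (Real.exp (8 * π) * majorantConst 1 2 * (1 + ‖iota2‖) ^ 2) * ell D ^ 9 := this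
    _ = _ := by ring

omit x in
/-- **`Σ_{ψ∈T} |H₂(s,ψ)|² ≤ e^{8π}·majorantConst(1,2)·(|ι₃|+|ι₄|)²·𝔓·𝓛⁹`** for `𝓛 ≥ 3`, any finite
`T ⊆ Ψ`, `|σ − ½| ≤ 2α`. [cite: Zhang2022LandauSiegel, Lemma 3.3 p.14; §2 (2.27); §13 (13.11) p.75] -/
theorem meanSq_H2_le_frakP (hL : 3 ≤ ell D) (T : Finset (Chr D)) {s : ℂ}
    (hs : |s.re - 1 / 2| ≤ 2 * alpha D) :
    ∑ x ∈ T, ‖H2 χ x s‖ ^ 2 ≤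
      Real.exp (8 * π) * majorantConst 1 2 * (‖iota3‖ + ‖iota4‖) ^ 2 * frakP D * ell D ^ 9 := by
  have hL1 : 1 ≤ ell D := by linarith
  have hD2 : 2 ≤ Real.log D := by have h := hL; rw [ell] at h; linarith
  obtain ⟨⟨hN2, -, hlog⟩, -⟩ := truncations_of_three_le hL
  obtain ⟨hN, -, -, -⟩ := short_truncations_of_three_le hL
  have ha : ∀ n : ℕ, n ≠ 0 → ‖(conj iota3 * vk3 D n + conj iota4 * vk2 D n)‖ ≤
      (‖iota3‖ + ‖iota4‖) * tau 1 n := fun n hn => by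
    rw [tau_one_apply hn, mul_one]; exact norm_coefH2_le hD2 n
  have h := meanSq_pc_le_of_le_tau_short χ hL1 T hs hN2 hN 1 ha
  simp_rw [H2_eq_sum χ]
  refine h.trans ?_
  have hK : 0 ≤ frakP D * (Real.exp (8 * π) * majorantConst 1 2 * (‖iota3‖ + ‖iota4‖) ^ 2) :=
    mul_nonneg (frakP_nonneg D) (mul_nonneg (mul_nonneg (Real.exp_nonneg _)
      (majorantConst_pos _ _).le) (sq_nonneg _))
  have := mul_le_mul_of_nonneg_left hlog hK
  simp only [one_pow, pow_one, Nat.mul_one] at this ⊢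
  calc frakP D * (Real.exp (8 * π) * majorantConst 1 2 * (‖iota3‖ + ‖iota4‖) ^ 2 *
        Real.log (⌈Skeleton.P1 D⌉₊ : ℕ))
      = frakP D * (Real.exp (8 * π) * majorantConst 1 2 * (‖iota3‖ + ‖iota4‖) ^ 2) *
        Real.log (⌈Skeleton.P1 D⌉₊ : ℕ) := by ring
    _ ≤ frakP D * (Real.exp (8 * π) * majorantConst 1 2 * (‖iota3‖ + ‖iota4‖) ^ 2) * ell D ^ 9 :=
        this
    _ = _ := by ring

omit x in
/-- **`Σ_{ψ∈T} |B(s,ψ)|² ≤ e^{8π}·majorantConst(4,4)·((1+|ι₂|)(|ι₃|+|ι₄|))²·𝔓·𝓛³⁶`** for `𝓛 ≥ 3`, any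
finite `T ⊆ Ψ` and `|σ − ½| ≤ 2α` — the `𝔓`-scale twin of `meanSq_Bpoly_le` (`B` has length
`PT⁻²η₊ < P`, so Lemma 3.3 (i) applies; `b ≪ τ₂`, (15.2); `Σ_{n≤N} τ₂(n)²/n ≪ (log N)⁴`, `log N ≤ 𝓛⁹`).
[cite: Zhang2022LandauSiegel, Lemma 3.3 p.14; §15 (15.1)–(15.2) p.79; §13 (13.11) p.75] -/
theorem meanSq_Bpoly_le_frakP (hL : 3 ≤ ell D) (T : Finset (Chr D)) {s : ℂ}
    (hs : |s.re - 1 / 2| ≤ 2 * alpha D) :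
    ∑ x ∈ T, ‖Bpoly χ x s‖ ^ 2 ≤
      Real.exp (8 * π) * majorantConst 4 4 * ((1 + ‖iota2‖) * (‖iota3‖ + ‖iota4‖)) ^ 2 *
        frakP D * ell D ^ 36 := by
  have hL1 : 1 ≤ ell D := by linarith
  have hD2 : 2 ≤ Real.log D := by have h := hL; rw [ell] at h; linarith
  obtain ⟨-, ⟨hN2, -, hlog⟩⟩ := truncations_of_three_le hL
  obtain ⟨-, hN, -, -⟩ := short_truncations_of_three_le hL
  have ha : ∀ n, n ≠ 0 → ‖bcoef D n‖ ≤ ((1 + ‖iota2‖) * (‖iota3‖ + ‖iota4‖)) * tau 2 n :=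
    fun n _ => norm_bcoef_le hD2 n
  have h := meanSq_pc_le_of_le_tau_short χ hL1 T hs hN2 hN 2 ha
  simp_rw [Bpoly_eq_sum_Ico χ _ hL]
  refine h.trans ?_
  have hlog0 : 0 ≤ Real.log ((⌊bigP D / bigT D ^ 2⌋₊ + 1 : ℕ) : ℝ) := Real.log_natCast_nonneg _
  have hpow : Real.log ((⌊bigP D / bigT D ^ 2⌋₊ + 1 : ℕ) : ℝ) ^ (2 ^ 2) ≤ ell D ^ 36 := by
    calc Real.log ((⌊bigP D / bigT D ^ 2⌋₊ + 1 : ℕ) : ℝ) ^ (2 ^ 2) ≤ (ell D ^ 9) ^ (2 ^ 2) :=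
          pow_le_pow_left₀ hlog0 hlog _
      _ = ell D ^ 36 := by ring
  have hK : 0 ≤ frakP D * (Real.exp (8 * π) *
      majorantConst (2 ^ 2) (2 * 2) * ((1 + ‖iota2‖) * (‖iota3‖ + ‖iota4‖)) ^ 2) :=
    mul_nonneg (frakP_nonneg D) (mul_nonneg (mul_nonneg (Real.exp_nonneg _)
      (majorantConst_pos _ _).le) (sq_nonneg _))
  have := mul_le_mul_of_nonneg_left hpow hK
  calc frakP D * (Real.exp (8 * π) * majorantConst (2 ^ 2) (2 * 2) *
        ((1 + ‖iota2‖) * (‖iota3‖ + ‖iota4‖)) ^ 2 *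
        Real.log ((⌊bigP D / bigT D ^ 2⌋₊ + 1 : ℕ) : ℝ) ^ (2 ^ 2))
      = frakP D * (Real.exp (8 * π) * majorantConst (2 ^ 2) (2 * 2) *
          ((1 + ‖iota2‖) * (‖iota3‖ + ‖iota4‖)) ^ 2) *
        Real.log ((⌊bigP D / bigT D ^ 2⌋₊ + 1 : ℕ) : ℝ) ^ (2 ^ 2) := by ring
    _ ≤ frakP D * (Real.exp (8 * π) * majorantConst (2 ^ 2) (2 * 2) *
          ((1 + ‖iota2‖) * (‖iota3‖ + ‖iota4‖)) ^ 2) * ell D ^ 36 := this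
    _ = _ := by rw [show (2 : ℕ) ^ 2 = 4 by norm_num, show (2 : ℕ) * 2 = 4 by norm_num]; ring

omit x in
/-- **The dual polynomial of `B` at the `𝔓`-scale**: for `𝓛 ≥ 3`, any finite `T ⊆ Ψ` and
`|σ − ½| ≤ 2α`, `Σ_{ψ∈T} |Σ_{1≤n<⌊PT⁻²⌋+1} conj(b(n))·conj(ψχ(n))·n^{−s}|² ≤` the bound of
`meanSq_Bpoly_le_frakP`. [cite: Zhang2022LandauSiegel, Lemma 3.3 p.14; §15 (15.2) p.79; §13 (13.11) p.75] -/
theorem meanSq_BpolyDual_le_frakP (hL : 3 ≤ ell D) (T : Finset (Chr D)) {s : ℂ}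
    (hs : |s.re - 1 / 2| ≤ 2 * alpha D) :
    ∑ x ∈ T, ‖∑ n ∈ Finset.Ico 1 (⌊bigP D / bigT D ^ 2⌋₊ + 1),
        conj (bcoef D n) * conj (pc χ x n) * (n : ℂ) ^ (-s)‖ ^ 2 ≤
      Real.exp (8 * π) * majorantConst 4 4 * ((1 + ‖iota2‖) * (‖iota3‖ + ‖iota4‖)) ^ 2 *
        frakP D * ell D ^ 36 := by
  have hL1 : 1 ≤ ell D := by linarith
  have hD2 : 2 ≤ Real.log D := by have h := hL; rw [ell] at h; linarith
  obtain ⟨-, ⟨hN2, -, hlog⟩⟩ := truncations_of_three_le hL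
  obtain ⟨-, hN, -, -⟩ := short_truncations_of_three_le hL
  have ha : ∀ n, n ≠ 0 → ‖conj (bcoef D n)‖ ≤ ((1 + ‖iota2‖) * (‖iota3‖ + ‖iota4‖)) * tau 2 n :=
    fun n _ => by rw [Complex.norm_conj]; exact norm_bcoef_le hD2 n
  have h := meanSq_pcConj_le_of_le_tau_short χ hL1 T hs hN2 hN 2 ha
  refine h.trans ?_
  have hlog0 : 0 ≤ Real.log ((⌊bigP D / bigT D ^ 2⌋₊ + 1 : ℕ) : ℝ) := Real.log_natCast_nonneg _
  have hpow : Real.log ((⌊bigP D / bigT D ^ 2⌋₊ + 1 : ℕ) : ℝ) ^ (2 ^ 2) ≤ ell D ^ 36 := by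
    calc Real.log ((⌊bigP D / bigT D ^ 2⌋₊ + 1 : ℕ) : ℝ) ^ (2 ^ 2) ≤ (ell D ^ 9) ^ (2 ^ 2) :=
          pow_le_pow_left₀ hlog0 hlog _
      _ = ell D ^ 36 := by ring
  have hK : 0 ≤ frakP D * (Real.exp (8 * π) *
      majorantConst (2 ^ 2) (2 * 2) * ((1 + ‖iota2‖) * (‖iota3‖ + ‖iota4‖)) ^ 2) :=
    mul_nonneg (frakP_nonneg D) (mul_nonneg (mul_nonneg (Real.exp_nonneg _)
      (majorantConst_pos _ _).le) (sq_nonneg _))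
  have := mul_le_mul_of_nonneg_left hpow hK
  calc frakP D * (Real.exp (8 * π) * majorantConst (2 ^ 2) (2 * 2) *
        ((1 + ‖iota2‖) * (‖iota3‖ + ‖iota4‖)) ^ 2 *
        Real.log ((⌊bigP D / bigT D ^ 2⌋₊ + 1 : ℕ) : ℝ) ^ (2 ^ 2))
      = frakP D * (Real.exp (8 * π) * majorantConst (2 ^ 2) (2 * 2) *
          ((1 + ‖iota2‖) * (‖iota3‖ + ‖iota4‖)) ^ 2) *
        Real.log ((⌊bigP D / bigT D ^ 2⌋₊ + 1 : ℕ) : ℝ) ^ (2 ^ 2) := by ring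
    _ ≤ frakP D * (Real.exp (8 * π) * majorantConst (2 ^ 2) (2 * 2) *
          ((1 + ‖iota2‖) * (‖iota3‖ + ‖iota4‖)) ^ 2) * ell D ^ 36 := this
    _ = _ := by rw [show (2 : ℕ) ^ 2 = 4 by norm_num, show (2 : ℕ) * 2 = 4 by norm_num]; ring

/-- `K(w,ψ)` in the `ψ(n)n^{−w}·weight` order, weight `g*(P₄/n)`. [cite: Zhang2022LandauSiegel, §6 Lemma 6.1 p.30] -/
theorem Kchar_psiFn_eq (w : ℂ) :
    Kchar D (psiFn x) w = ∑ n ∈ Finset.Ico 1 ⌈2 * P4 D⌉₊,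
      x.ψ (n : ZMod x.p) * (n : ℂ) ^ (-w) * (gstar D (P4 D / n) : ℂ) := by
  rw [Kchar]; rfl

/-- `K(w,ψ̄)` in the `ψ̄(n)n^{−w}·weight` order. [cite: Zhang2022LandauSiegel, §6 Lemma 6.1 p.30; §13 (13.3)] -/
theorem Kchar_psiBarFn_eq (w : ℂ) :
    Kchar D (psiBarFn x) w = ∑ n ∈ Finset.Ico 1 ⌈2 * P4 D⌉₊,
      conj (x.ψ (n : ZMod x.p)) * (n : ℂ) ^ (-w) * (gstar D (P4 D / n) : ℂ) := by
  rw [Kchar]; rfl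

/-- `N(w,ψ)` in the `ψ(n)n^{−w}·weight` order, weight `g*(T²/n)`. [cite: Zhang2022LandauSiegel, §6 Lemma 6.1 p.30] -/
theorem Nchar_psiFn_eq (w : ℂ) :
    Nchar D (psiFn x) w = ∑ n ∈ Finset.Ico 1 ⌈2 * bigT D ^ 2⌉₊,
      x.ψ (n : ZMod x.p) * (n : ℂ) ^ (-w) * (gstar D (bigT D ^ 2 / n) : ℂ) := by
  rw [Nchar]; rfl

/-- `N(w,ψ̄)` in the `ψ̄(n)n^{−w}·weight` order. [cite: Zhang2022LandauSiegel, §6 Lemma 6.1 p.30] -/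
theorem Nchar_psiBarFn_eq (w : ℂ) :
    Nchar D (psiBarFn x) w = ∑ n ∈ Finset.Ico 1 ⌈2 * bigT D ^ 2⌉₊,
      conj (x.ψ (n : ZMod x.p)) * (n : ℂ) ^ (-w) * (gstar D (bigT D ^ 2 / n) : ℂ) := by
  rw [Nchar]; rfl

omit χ x in
/-- **`Σ_{ψ∈T} |N(w,ψ)|² ≤ 𝔓·e^{8π}·(2 + 𝓛⁹)`** for `𝓛 ≥ 3`, any finite `T ⊆ Ψ`, `|Re w − ½| ≤ 2α`
(length `2T² < P`, weights `|g*| ≤ 1`). [cite: Zhang2022LandauSiegel, Lemma 3.3 p.14; §6 Lemma 6.1 p.30] -/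
theorem meanSq_Nchar_le_frakP (hL : 3 ≤ ell D) (T : Finset (Chr D)) {w : ℂ}
    (hw : |w.re - 1 / 2| ≤ 2 * alpha D) :
    ∑ x ∈ T, ‖Nchar D (psiFn x) w‖ ^ 2 ≤ frakP D * (Real.exp (8 * π) * (2 + ell D ^ 9)) := by
  have hL1 : 1 ≤ ell D := by linarith
  have hL0 : 0 < ell D := by linarith
  obtain ⟨-, -, hN, -⟩ := short_truncations_of_three_le hL
  simp_rw [Nchar_psiFn_eq]
  refine (meanSq_psiW_le_short_of_le_one hL1 T hw hN
    (fun n => norm_gstar_le_one hL0 _)).trans ?_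
  have hlog := log_le_of_le_floor_bigP hN
  refine mul_le_mul_of_nonneg_left ?_ (frakP_nonneg D)
  exact mul_le_mul_of_nonneg_left (by linarith) (Real.exp_nonneg _)

omit χ x in
/-- **`Σ_{ψ∈T} |N(w,ψ̄)|² ≤ 𝔓·e^{8π}·(2 + 𝓛⁹)`** for `𝓛 ≥ 3`, any finite `T ⊆ Ψ`, `|Re w − ½| ≤ 2α`.
[cite: Zhang2022LandauSiegel, Lemma 3.3 p.14; §6 Lemma 6.1 p.30] -/
theorem meanSq_NcharBar_le_frakP (hL : 3 ≤ ell D) (T : Finset (Chr D)) {w : ℂ}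
    (hw : |w.re - 1 / 2| ≤ 2 * alpha D) :
    ∑ x ∈ T, ‖Nchar D (psiBarFn x) w‖ ^ 2 ≤ frakP D * (Real.exp (8 * π) * (2 + ell D ^ 9)) := by
  have hL1 : 1 ≤ ell D := by linarith
  have hL0 : 0 < ell D := by linarith
  obtain ⟨-, -, hN, -⟩ := short_truncations_of_three_le hL
  simp_rw [Nchar_psiBarFn_eq]
  refine (meanSq_psiBarW_le_short_of_le_one hL1 T hw hN
    (fun n => norm_gstar_le_one hL0 _)).trans ?_
  have hlog := log_le_of_le_floor_bigP hN
  refine mul_le_mul_of_nonneg_left ?_ (frakP_nonneg D)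
  exact mul_le_mul_of_nonneg_left (by linarith) (Real.exp_nonneg _)

omit χ x in
/-- **`Σ_{ψ∈T} |K(w,ψ)|² ≤ 𝔓·e^{8π}·(2 + 𝓛⁹)`** for `𝓛 ≥ 3`, `2P₄ + 1 ≤ P` (all large `D`,
`eventually_two_P4_add_one_le`), any finite `T ⊆ Ψ`, `|Re w − ½| ≤ 2α` (length `2P₄ < P`, weights
`|g*| ≤ 1`). [cite: Zhang2022LandauSiegel, Lemma 3.3 p.14; §6 Lemma 6.1 p.30] -/
theorem meanSq_Kchar_le_frakP (hL : 3 ≤ ell D) (hP4 : 2 * P4 D + 1 ≤ bigP D) (T : Finset (Chr D))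
    {w : ℂ} (hw : |w.re - 1 / 2| ≤ 2 * alpha D) :
    ∑ x ∈ T, ‖Kchar D (psiFn x) w‖ ^ 2 ≤ frakP D * (Real.exp (8 * π) * (2 + ell D ^ 9)) := by
  have hL1 : 1 ≤ ell D := by linarith
  have hL0 : 0 < ell D := by linarith
  have hN := ceil_two_P4_le hP4
  simp_rw [Kchar_psiFn_eq]
  refine (meanSq_psiW_le_short_of_le_one hL1 T hw hN
    (fun n => norm_gstar_le_one hL0 _)).trans ?_
  have hlog := log_le_of_le_floor_bigP hN
  refine mul_le_mul_of_nonneg_left ?_ (frakP_nonneg D)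
  exact mul_le_mul_of_nonneg_left (by linarith) (Real.exp_nonneg _)

omit χ x in
/-- **`Σ_{ψ∈T} |K(w,ψ̄)|² ≤ 𝔓·e^{8π}·(2 + 𝓛⁹)`** for `𝓛 ≥ 3`, `2P₄ + 1 ≤ P`, any finite `T ⊆ Ψ`,
`|Re w − ½| ≤ 2α` (the conjugate-character `K` of (13.3)–(13.5) and of §15.u008's `M₁`).
[cite: Zhang2022LandauSiegel, Lemma 3.3 p.14; §6 Lemma 6.1 p.30; §15 p.80] -/
theorem meanSq_KcharBar_le_frakP (hL : 3 ≤ ell D) (hP4 : 2 * P4 D + 1 ≤ bigP D) (T : Finset (Chr D))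
    {w : ℂ} (hw : |w.re - 1 / 2| ≤ 2 * alpha D) :
    ∑ x ∈ T, ‖Kchar D (psiBarFn x) w‖ ^ 2 ≤ frakP D * (Real.exp (8 * π) * (2 + ell D ^ 9)) := by
  have hL1 : 1 ≤ ell D := by linarith
  have hL0 : 0 < ell D := by linarith
  have hN := ceil_two_P4_le hP4
  simp_rw [Kchar_psiBarFn_eq]
  refine (meanSq_psiBarW_le_short_of_le_one hL1 T hw hN
    (fun n => norm_gstar_le_one hL0 _)).trans ?_
  have hlog := log_le_of_le_floor_bigP hN
  refine mul_le_mul_of_nonneg_left ?_ (frakP_nonneg D)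
  exact mul_le_mul_of_nonneg_left (by linarith) (Real.exp_nonneg _)

end Instances

end Literature.NumberTheory.LFunctions.Zhang2022.Typed.Section13

end
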